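import Mathlib
import HarnessLib
import HarnessLib.Audit
import Summits.CriticalPhenomena.Statement

/-!
Route: PercDislocationCovers

CLOSED (superseded) 2026-08-15T12:34:35Z by planner-plancard-CriticalPhenomena-Percolatio-f4bba8ba-0 — reason: superseded:route-CriticalPhenomena-PercLoopDislocationCovers — superseded by route-CriticalPhenomena-PercLoopDislocationCovers — note: Duplicate ledger row created by a gate crash ('empty response from gate') during the first route open at 11:47Z; the same six items (stmt-CriticalPhenomena-6528..6533) were re-filed under the final name PercLoopDislocationCovers (loop-dislocation construction). No content differs; keep the Loop rout. The file is kept as the record of this route; refuted decls are indexed as negative knowledge (`ledger negatives`).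

# Route PercDislocationCovers — lift to loop-dislocated covers of Z^3 — continuity = cover slope
s^(5/6) vs subcritical shift (nu' < 6/5), both below p_c

It suffices to show X = C1 ∧ C2a [card
CriticalPhenomena/PercolationContinuityZ3/dislocation-covers-monotone-lift, re-engineered]:
for the EXPLICIT family G_s (s ≥ 2) of covering graphs of ℤ³ — vertex set ℤ³ × (words in letters
ℤ³), sheets exchanged by a
ℤ/2-holonomy when a bond crosses one of a periodic array (period s) of square "dislocation-loop"
patches of y-bonds of side ⌊s/2⌋,
independent letters per patch (deck group = free product of ℤ/2's: nonamenable, exponential growth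
exp(Θ(1/s)), quasi-transitive,
balls of radius < s/2 around the base point õ = (0, []) are ℤ³-balls) —
 (C1) CoverSlopeBound: θ_{G_s}(õ, p) ≤ C s^{5/6} (p − p_c(G_s, õ))₊ for all p ≤ p_c(ℤ³) (a
mean-field slope bound for the cover
 ACROSS ITS OWN critical point, constant polynomial in the dislocation spacing, only in the regime
where the base is subcritical or critical);
 (C2a) Z3SubcritLengthExponent: a finite-size form of ξ(p_c − ε) ≤ C ε^{−ν'} on ℤ³ with SOME ν' <
6/5.
With the provable support items (covering monotonicity θ_{ℤ³}(0,p) ≤ θ_{G_s}(õ,p) pointwise in p;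
Prod.fst is a covering map;
CoverSubcritTransfer: G_s is subcritical whenever the ℤ³ finite-size criterion holds at a scale L
with C₀ L log L ≤ s) one gets
p_c(G_s) ≥ p_c(ℤ³) − ε_s with ε_s ≈ (s/log s)^{−1/ν'}, hence θ(p_c) ≤ θ_{G_s}(õ, p_c) ≤ C s^{5/6}
ε_s → 0 because 5/6 < 1/ν'.
Lean: `((fun G : ℕ → SimpleGraph (Literature.Probability.LatticeModels.Site 3 × List (ℤ × ℤ × ℤ)) =>
∃ C : ℝ, ∀ s : ℕ, 2 ≤ s → ∀ p : unitInterval, (p : ℝ) ≤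
Literature.Probability.Percolation.criticalProb (Literature.Probability.LatticeModels.zdGraph 3) 0 →
Literature.Probability.Percolation.theta (G s) ((0 : Literature.Probability.LatticeModels.Site 3),
([] : List (ℤ × ℤ × ℤ))) p ≤ C * (s : ℝ) ^ ((5 : ℝ) / 6) * max 0 ((p : ℝ) -
Literature.Probability.Percolation.criticalProb (G s) ((0 :
Literature.Probability.LatticeModels.Site 3), ([] : List (ℤ × ℤ × ℤ))))) (fun s : ℕ =>
SimpleGraph.fromRel (fun x y : Literature.Probability.LatticeModels.Site 3 × List (ℤ × ℤ × ℤ) =>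
(Literature.Probability.LatticeModels.zdGraph 3).Adj x.1 y.1 ∧ y.2 = (if y.1 = x.1 + (Pi.single 1 1
: Literature.Probability.LatticeModels.Site 3) ∧ (s : ℤ) ∣ x.1 1 - (s / 2 : ℕ) ∧ (x.1 0 - (s / 2 :
ℕ)) % (s : ℤ) < (s / 2 : ℕ) ∧ x.1 2 % (s : ℤ) < (s / 2 : ℕ) then some ((x.1 0 - (s / 2 : ℕ)) / (s :
ℤ), (x.1 1 - (s / 2 : ℕ)) / (s : ℤ), x.1 2 / (s : ℤ)) else if x.1 = y.1 + (Pi.single 1 1 :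
Literature.Probability.LatticeModels.Site 3) ∧ (s : ℤ) ∣ y.1 1 - (s / 2 : ℕ) ∧ (y.1 0 - (s / 2 : ℕ))
% (s : ℤ) < (s / 2 : ℕ) ∧ y.1 2 % (s : ℤ) < (s / 2 : ℕ) then some ((y.1 0 - (s / 2 : ℕ)) / (s : ℤ),
(y.1 1 - (s / 2 : ℕ)) / (s : ℤ), y.1 2 / (s : ℤ)) else none).elim x.2 (fun P => if x.2.head? = some
P then x.2.tail else P :: x.2)))) ∧ (∃ ν C : ℝ, ν < 6 / 5 ∧ ∀ p : unitInterval, (p : ℝ) <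
Literature.Probability.Percolation.criticalProb (Literature.Probability.LatticeModels.zdGraph 3) 0 →
∀ L : ℕ, C * (Literature.Probability.Percolation.criticalProb
(Literature.Probability.LatticeModels.zdGraph 3) 0 - p) ^ (-ν) ≤ L → ((2 * L + 1) ^ 3 : ℝ) *
(Literature.Probability.Percolation.bondPercolation (Literature.Probability.LatticeModels.zdGraph 3)
p).real (Literature.Probability.Percolation.siteToBoundary 3 L) ≤ 1 / 2)`

## Assembly
Elementary real analysis + the definition of `criticalProb` (planner Sketch.lean rc 0; `Assembly`
unfolds by `rfl` to `… → theta (zdGraph 3) 0 (criticalProbI 3) = 0`).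
Fix the constants ν' < 6/5, C₁ of Z3SubcritLengthExponent and C₀ of CoverSubcritTransfer. For s
large put L_s := ⌊s / (C₀ (log₂ s + 1))⌋ ≥ 1
(then C₀ L_s (log₂ L_s + 1) ≤ s) and ε_s := (C₁ / L_s)^{1/ν'} (case ν' > 0, C₁ > 0; if ν' ≤ 0 or C₁
≤ 0 the criterion holds for all
p < p_c at a fixed scale and the argument only simplifies). For p ≤ p_c − ε_s: C₁ (p_c − p)^{−ν'} ≤
L_s, so the criterion holds at
(L_s, p) and CoverSubcritTransfer gives θ_{G_s}(õ, p) = 0; hence p_c(G_s, õ) ≥ p_c − ε_s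
(criticalProb is an sInf over {p | θ > 0} ∪ {1}).
CoverSlopeBound at p = criticalProbI 3 gives θ_{G_s}(õ, p_c) ≤ C s^{5/6} ε_s ≤ C' s^{5/6 − 1/ν'}
(log s)^{1/ν'} → 0 since 1/ν' > 5/6.
CoverIsCovering feeds CoverMonotone with φ = Prod.fst, φ õ = 0: θ_{ℤ³}(0, p_c) ≤ θ_{G_s}(õ, p_c) for
every s ≥ 2; so θ(p_c) ≤ 0 ≤ θ(p_c).
No unproved named Literature fact is used anywhere in the route (Hutchcroft2016's theorem is implied
by CoverSlopeBound at p = p_c(G_s), not assumed).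

Rationale: WHY THIS LINE. Deform the GRAPH, not the measure, in the one direction that comes with a free
inequality: for a (weak) covering map φ : G → ℤ³,
θ_{ℤ³}(φ x, p) ≤ θ_G(x, p) for every p (Campanino 1985; BenjaminiSchramm1996 Thm 1; LyonsPeres2016
Thm 6.47, verified pp. 316–317 of the held
copy), so θ(p_c) ≤ inf_s θ_{G_s}(õ, p_c(ℤ³)). The approximants are chosen SOLVABLE from the
hyperbolic side: finite-order dislocation
LOOPS make every lifted core finite, so outside the cores G_s is a disjoint union of copies of a
strictly subcritical ℤ³-subgraph
(p_c(ℤ³ minus patches) > p_c(ℤ³), AizenmanGrimmett1991) glued in the pattern of the Bass–Serre tree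
of a free product of ℤ/2's —
percolation on such tree-graded graphs is a Galton–Watson process over the pieces (Kozáková
arXiv:math/0611668, Špakulová arXiv:0801.4153),
mean-field across p_c(G_s), and Hutchcroft2016 / arXiv:2002.02916 / arXiv:2207.00701 is the general
nonamenable theory behind C1.
Imported areas: covering-space / geometric group theory (free products, tree-graded structure,
nonamenability), branching processes,
nonamenable percolation; the ℤ³ input is purely SUBCRITICAL (ν' < 6/5 and, inside C1, a Newman-type
'jump ⇒ ν ≥ 6/5' inequality) —
unlike the nine existing routes of this conjunct, which all posit hypotheticals AT or ABOVE p_c(ℤ³).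
Negatives index: nothing related.

RANKED CRUXES. #2 CoverSlopeBound (crux) — (card crux C1, restricted to p ≤ p_c(ℤ³) so that it does
not silently contain β ≥ 1/6 above p_c) there is C such that for every s ≥ 2 and every p ≤ p_c(ℤ³):
θ_{G_s}(õ, p) ≤ C · s^{5/6} · max(0, p − p_c(G_s, õ)), G_s the explicit loop-dislocated cover
(inlined `SimpleGraph.fromRel` term), õ = (0, []). At p < p_c(G_s) trivial; at p = p_c(G_s) it is
Hutchcroft's θ_{G_s}(p_c(G_s)) = 0; on (p_c(G_s), p_c(ℤ³)] it is a linear (β_cover ≥ 1) bound with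
constant s^{5/6}; scaling prediction for the true constant: s^{(1−β)/ν} ≈ s^{0.66}, binding at p =
p_c(ℤ³). [difficulty: open-problem] (why it might fail: Binding point p = p_c(Z^3): there it reads
pi_{p_c}(s) <~ s^(5/6) Delta_s, a Newman-type 'jump => nu >= 6/5' inequality no present tool gives;
the free-product/Galton-Watson regime controls theta_{G_s} only while xi(p) <~ s/log s, and
L^2/triangle constants on G_s scale like s^2 or worse.) [arXiv:2002.02916, arXiv:2207.00701,
arXiv:1904.05804, arXiv:math/0611668, arXiv:0801.4153, Hutchcroft2016, BenjaminiSchramm1996,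
LyonsPeres2016, Newman1986, zbl:0948.60098]
#3 Z3SubcritLengthExponent (crux) — (card crux C2, ℤ³ part, least usable exponent) there are ν' <
6/5 and C such that for every p < p_c(ℤ³) and every L ≥ C (p_c − p)^{−ν'} the finite-size criterion
(2L+1)³ · P_p(0 ↔ ∂B(L)) ≤ 1/2 holds (event `siteToBoundary 3 L`, the one of `perc_sharpness`); i.e.
the subcritical correlation length of bond percolation on ℤ³ obeys ξ(p_c − ε) log ξ ≲ ε^{−ν'} with
ν' < 6/5 (numerics: ν ≈ 0.876). Pure ℤ³, subcritical, shareable with other routes (cf.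
PercDebrisSweep's SubcritChiBelowCube, PercTwoPointDecay r2). [difficulty: open-problem] (why it
might fail: No polynomial bound on the subcritical correlation length of Z^3 is known at all (best:
xi(p_c - eps) <= exp(C/eps^2), DuminilcopinKozmaTassion2020); a first proof would likely give a huge
exponent, while the race needs nu' < 6/5 (truth nu ~ 0.88; a jump world may have nu = infinity).)
[DuminilcopinKozmaTassion2020, DuminilCopinTassionCMP2016, Grimmett1999, AizenmanNewman1984,
Hutchcroft2020]
#9 CoverSubcritTransfer (support) — (card crux C2, cover part — made provable by FINITE cores) there
is C₀ such that for all s ≥ 2, L ≥ 1 with C₀ L (log₂ L + 1) ≤ s and all p < p_c(ℤ³) satisfying the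
criterion (2L+1)³ P_p(0 ↔ ∂B(L)) ≤ 1/2, the cover does not percolate: θ_{G_s}(õ, p) = 0. Proof plan
(~1.5k lines): (i) Hammersley/Simon–Lieb iteration via bk_inequality_holds: P_p(0 ↔ ∂B(kL)) ≤
2^{1−k}, so τ_p(y,z) ≤ 2·2^{−|y−z|_∞/L}; (ii) geometry of the explicit cover: bonds outside the
patches carry trivial holonomy, so G_s minus the (finite!) lifted patch cores is a disjoint union of
copies of F_s = ℤ³ minus patches ⊆ ℤ³, and each lifted core has ≤ 2·(s/2)²·2 vertices; (iii)
core-to-core bridging number m ≤ C s⁴ 2^{−s/(2L)} < 1 once s ≥ C₀ L log L (patches are ≥ s/2 apart);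
(iv) BK over chains of distinct lifted cores ⇒ E[#cores in C(õ)] < ∞ ⇒ with a.s.-finite F-clusters
(theta_eq_zero_of_lt_criticalProb_holds + subgraph monotonicity) C(õ) is a.s. finite. [difficulty:
L] [Grimmett1999, LyonsPeres2016, Literature.Probability.Percolation.bk_inequality_holds,
Literature.Probability.Percolation.perc_sharpness_holds]
#9 CoverMonotone (support) — covering monotonicity (Campanino 1985; BenjaminiSchramm1996 Thm 1;
LyonsPeres2016 Thm 6.47, pp. 316–317 of the held copy): if φ : V → W maps the G-neighbourhood of
every vertex ONTO the H-neighbourhood of its image (weak covering, vertex form), then θ_H(φ v, p) ≤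
θ_G(v, p) for all v, p. Proof = LP's exploration coupling: explore C(φ v) in H edge by edge, lift
each newly examined edge to a fresh G-edge at the current lifted endpoint (exists by SurjOn;
distinct H-edges lift to distinct G-edges), copy its state; an infinite H-cluster lifts to an
infinite open tree at v. Countable V, W for measurability. [difficulty: provable-now]
[LyonsPeres2016, BenjaminiSchramm1996, doi:10.1214/ecp.v1-978]
#9 CoverIsCovering (support) — sanity/canary for the explicit construction: for every s ≥ 2 and
every vertex v of G_s, Prod.fst restricted to the G_s-neighbours of v is a bijection onto the
ℤ³-neighbours of v.1 (so Prod.fst is a covering map and CoverMonotone applies with φ = Prod.fst, φ õ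
= 0). Finite case analysis on the two `if` branches (the word update w ↦ toggle_P w is an
involution; non-y-bonds and y-bonds off the patches keep the word). [difficulty: provable-now]
[LyonsPeres2016, BenjaminiSchramm1996]

TWO-LAYER PLAN. CoverSlopeBound ⇐ FreeProductMeanField → NewmanTypeSlope → CoverSlopeBound (k = 2,
depth 1): FreeProductMeanField = for p ≤ p_c(ℤ³),
θ_{G_s}(õ,p) ≤ C s^A · P_p(0 ↔ ∂B(s/4)) · (m_s(p) − 1)₊-type Galton–Watson bound over the tree of
lifted cores (pieces F_s strictly
subcritical on [0, p_c(ℤ³)] by AizenmanGrimmett1991; Kozáková/Špakulová generating-function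
calculus; left-continuity of θ_{G_s} above
p_c(G_s) by Häggström–Peres–Schonmann merging, zbl:0948.60098); NewmanTypeSlope = the residual ℤ³
inequality at the binding point,
π_{p_c}(s) ≤ C s^{5/6} · (p_c − ξ^{−1}(s/ log s)) ('a jump forces ν ≥ 6/5').
Z3SubcritLengthExponent: no split foreseen (a proof would
come with its own ladder). CoverSubcritTransfer ⇐ CriterionIteration → CoreBridgingSubunit →
CoverSubcritTransfer if a prover asks.

KILL CRITERIA. (i) ¬CoverIsCovering (the construction is not a covering of ℤ³) or infinite lifted
cores: every cover item must be restated with a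
corrected family (route edit --restate ×3) — not a kill of the line, but of this filing; (ii) a
proof, numerical certificate or heuristic
consensus that the shift p_c(ℤ³) − p_c(G_s) decays no faster than s^{−5/6} (equivalently ξ(p_c − ε)
≳ ε^{−6/5} at the scales probed)
refutes CoverSlopeBound ∧ Z3SubcritLengthExponent jointly → close refuted:CoverSlopeBound; (iii)
Z3SubcritLengthExponent refuted
(ν ≥ 6/5 rigorously) → close; (iv) a theorem that slightly supercritical θ on EVERY quasi-transitive
cover of ℤ³ inherits the base
one-arm factor only at scale ξ (i.e. that C1's constant is ≥ s^{1/ν'} for any provable ν') collapses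
the race to a tie → close as
exhausted; (v) moot if π_{p_c}(n) → 0 is proved directly (PercTwoPointDecay X_A,
PercLowPointHalfSpace) — then θ(p_c) = 0 outright.

NOT DECOMPOSED YET. The Galton–Watson/free-product structure of G_s (offspring law of a lifted core,
its variance, Russo bounds on dm/dp), the
left-continuity input (HPS merging on quasi-transitive G_s), the Cheeger constant h(G_s) ≍ 1/s and
the universal form of C1
('θ_G(p_c(G)+Δ) ≤ C(deg) h(G)^{−5/6} Δ for nonamenable quasi-transitive G' — not excluded by any
ℤ^d-based example since
sup_d (1−β_d)/ν_d ≈ 0.66 < 5/6), the quasi-transitivity / exponential-growth / unimodularity checks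
of G_s (not needed by the
Assembly), and every constant in CoverSubcritTransfer. Prior programme: not consulted (plancard
mode).

CHEAPEST FALSIFIER. (1) Lean, hours: settle CoverIsCovering for s = 2, 3, 4 by case analysis (the
#guard tests of the planner's TestLoop.lean already check the
patch geometry, the ℤ/2 involution and trivial holonomy off the patches on sample bonds). (2) kit
Monte Carlo, ~1 cpu-day: bond
percolation on the double cover of an N³ torus branched along ONE square loop of side N/4 (two
sheets, rewired y-bonds through the
patch): wrapping probabilities at p = 0.2488 must agree with the plain torus within error (p_c
unchanged by a finite-order dislocation
loop; a measurable shift kills CoverSubcritTransfer's premise that cores are inert) and, on G_s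
truncated to sheets of word-length ≤ 3,
the onset of sheet-to-sheet percolation must sit at ξ(p) ≈ s/(2 log s), i.e. shift exponent ≈ 1/ν ≈
1.14 > 5/6. (3) Literature: a
quantitative Martineau–Severo bound p_c(ℤ³) − p_c(G) ≥ f(tameness radius) with f(s) ≫ s^{−5/6} would
kill the race; their proof
(arXiv:1803.09686, Thm 2.1 / Cor 2.3) gives an exponentially small f, consistent. None of (1)–(3)
could be run this session (hub compute-free; kit not in payload).

NUMBERS. p_c^bond(ℤ³) ≈ 0.24881; ν ≈ 0.876, β ≈ 0.418, β/ν ≈ 0.477 (one-arm), (1−β)/ν ≈ 0.664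
(predicted true slope exponent of C1),
1/ν ≈ 1.141 (predicted shift exponent); thresholds filed: slope 5/6 ≈ 0.833 (margin 0.17), ν' < 6/5
(margin 0.32), race
s^{5/6 − 1/ν'} → 0. Rigorous: ξ(p_c − ε) ≤ exp(C ε^{−2}) (DuminilcopinKozmaTassion2020, d ≥ 3); jump
⇒ γ ≥ 2 (Newman1986 /
AizenmanNewman1984-type), hence with χ ≤ C (ξ log ξ)³ only ν_jump ≥ 2/3 classically — C1 upgrades
this to 6/5 via the cover.
Cover data: gr(G_s) = exp(Θ(1/s)); flat radius of õ ≈ s/2; patches side ⌊s/2⌋, spacing s (gaps ≥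
s/2); lifted core ≤ 2·2·(s/2)² vertices;
predicted p_c(G_s) at ξ(p) ≈ s/(2 log s). Items at open: 6 (2 cruxes, 3 support, 1 assembly).

DEFINITION REQUESTS. `dislocationLoopCover (s : ℕ) : SimpleGraph (Site 3 × List (ℤ × ℤ × ℤ))` under
Summits/CriticalPhenomena/PercolationContinuityZ3/Theorems
(= the inlined `SimpleGraph.fromRel …` term of the items; once it lands the tenure planner restates
the three cover items by name) and,
optionally, `IsWeakCovering φ G H := ∀ v, Set.SurjOn φ (G.neighborSet v) (H.neighborSet (φ v))`
under Literature/Probability/Percolation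
(LyonsPeres2016 §6.9). Filed with `ledger workitem add --kind definition` right after open. No cite
facts wanted: the Assembly uses none.

Novelty: Searches (2026-08-15, this session): lit frontier CriticalPhenomena --since 2020 (30 rows, none on
covers/quotients); lit bridges
CriticalPhenomena --cross any (30 rows, none); zbMATH: 'percolation covering graph critical
probability' (10; MartineauSevero2019 =
arXiv:1803.09686 the only relevant), 'locality critical probability percolation transitive graphs'
(8: arXiv:1808.08940, arXiv:2310.10983,
arXiv:2205.10253, MartineauTassion2017, arXiv:1410.2453), 'slightly supercritical percolation
nonamenable' (1: arXiv:2207.00701),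
'upper bounds percolation correlation length' (arXiv:1902.03207), 'critical percolation free product
of groups' (arXiv:math/0611668),
'critical percolation virtually free groups tree-like graphs' (arXiv:0801.4153), 'Haggstrom Peres
Schonmann relentless merging'
(zbl:0948.60098); 'Ising/percolation screw dislocation', 'percolation lattice defect line
dislocation threshold', 'branched covering cone
angle lattice', 'infinite sheeted Riemann surface lattice' (0 relevant each; crossref returns only
metallurgy); lit read LyonsPeres2016
pp. 316–317 (Thm 6.47 and proof quoted); held Haggstrom2011 survey grep 'cover' (nothing); local
searchd down (connection reset),
arXiv/OpenAlex/S2 HTTP 429, galaxy --star all queued > 90 s (recorded). Plus the card's and the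
novelty audit's searches (LP 6.47, BS96,
M–S Cor 2.3, Hutchcroft 1605.05301, zbMATH ×4, galaxy pdf).
Nearest prior art found: BenjaminiSchramm1996 Thm 1 / LyonsPeres2016 Thm 6.47 (θ_base ≤ θ_cover
pointwise  [refs: 1803.09686, 1808.08940, 2310.10983, 2205.10253, 1410.2453, 2207.00701, 1902.03207, math/0611668, 0801.4153, 2002.02916, MartineauSevero2019, MartineauTassion2017, LyonsPeres2016, Haggstrom2011, BenjaminiSchramm1996, Hutchcroft2016]

Barriers (technique_class: covering-lift, hyperbolic-approximant, monotone-comparison): - technique_class: covering-lift, hyperbolic-approximant, monotone-comparison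
- Literature.Barriers.CriticalPhenomena.SubexponentialGrowthZd: evaded in form — nothing of the
growth/susceptibility method is applied to ℤ³ (gr = 1); G_s has gr = exp(Θ(1/s)) > 1 and ℤ³ enters
only through θ_{ℤ³} ≤ θ_{G_s}; Hutchcroft2016 is not even a logical input (CoverSlopeBound at p =
p_c(G_s) contains it). Not evaded in substance: the degeneration of every nonamenable constant as s
→ ∞ IS crux CoverSlopeBound (asked: ≤ s^{5/6}); the bet is stated, not hidden.
- Literature.Barriers.CriticalPhenomena.AmenableInvariantPercolation: not engaged on ℤ³ — no
invariant-percolation density threshold is invoked on the amenable lattice; mass-transport/BLPS-type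
tools would act on G_s (Cheeger ≍ 1/s > 0), with the s-dependence again inside CoverSlopeBound. Same
for AmenableInvariantPercolationZd / …Bond / …Profile and BLPSCriticalReduction.
- Literature.Barriers.CriticalPhenomena.SlabLimitUniformControl: the structural twin from the other
side (slabs ↑ ℤ³ need a uniform modulus, DST Prop. 3). It does not evade the need for uniform
control; the bet is that approaching from the hyperbolic side (covers ↓ ℤ³, comparison inequality
free and pointing the right way, no exhaustion identity) the control needed is SUBcritical — ν' <
6/5 plus a Newman-type slope inequality — instead of an RSW/critical input, and it is filed as two
refutable exponent bounds.
- Literature.Barriers.CriticalPhenomena.SprinklingRenormal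

History (route lifecycle, newest last):
- 2026-08-15T12:34:36Z · CLOSED superseded — superseded:route-CriticalPhenomena-PercLoopDislocationCovers (planner-plancard-CriticalPhenomena-Percolatio-f4bba8ba-0)

sub-problem: PercolationContinuityZ3 · status: closed(superseded) · opened planner-plancard-CriticalPhenomena-Percolatio-f4bba8ba-0 2026-08-15T11:47:56Z · rev 0 · ledger route-CriticalPhenomena-PercDislocationCovers
GENERATED by the gate from the ledger (D-0016/17). Provers cite these decls: `theorem foo : Summit.CriticalPhenomena.PercolationContinuityZ3.Theses.PercDislocationCovers.<Decl> := …` in Summits/CriticalPhenomena/PercolationContinuityZ3/Theorems/<Name>.lean.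
-/

namespace Summit.CriticalPhenomena.PercolationContinuityZ3.Theses.PercDislocationCovers

open scoped BigOperators Topology Manifold Classical MeasureTheory ProbabilityTheory Matrix InnerProductSpace ComplexConjugate ContinuousMap
open Filter Set Function TopologicalSpace MeasureTheory

attribute [summit_statement] _root_.PercolationContinuityZ3

/-- item stmt-CriticalPhenomena-6528 · crux · rank 2 · open · by planner
why it might fail: Binding point p = p_c(Z^3): there it reads pi_{p_c}(s) <~ s^(5/6) Delta_s, a Newman-type 'jump => nu >= 6/5' inequality no present tool gives; the free-product/Galton-Watson regime controls theta_{G_s} only while xi(p) <~ s/log s, and L^2/triangle constants on G_s scale like s^2 or worse.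
sources: arXiv:2002.02916, arXiv:2207.00701, arXiv:1904.05804, arXiv:math/0611668, arXiv:0801.4153, Hutchcroft2016
[crux] (card crux C1, restricted to p ≤ p_c(ℤ³) so that it does not silently contain β ≥ 1/6 above
p_c) there is C such that for every s ≥ 2 and every p ≤ p_c(ℤ³): θ_{G_s}(õ, p) ≤ C · s^{5/6} ·
max(0, p − p_c(G_s, õ)), G_s the explicit loop-dislocated cover (inlined `SimpleGraph.fromRel`
term), õ = (0, []). At p < p_c(G_s) trivial; at p = p_c(G_s) it is Hutchcroft's θ_{G_s}(p_c(G_s)) =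
0; on (p_c(G_s), p_c(ℤ³)] it is a linear (β_cover ≥ 1) bound with constant s^{5/6}; scaling
prediction for the true constant: s^{(1−β)/ν} ≈ s^{0.66}, binding at p = p_c(ℤ³). [difficulty:
open-problem] -/
@[route_item "route-CriticalPhenomena-PercDislocationCovers"]
def CoverSlopeBound : Prop :=
  (fun G : ℕ → SimpleGraph (Literature.Probability.LatticeModels.Site 3 × List (ℤ × ℤ × ℤ)) => ∃ C : ℝ, ∀ s : ℕ, 2 ≤ s → ∀ p : unitInterval, (p : ℝ) ≤ Literature.Probability.Percolation.criticalProb (Literature.Probability.LatticeModels.zdGraph 3) 0 → Literature.Probability.Percolation.theta (G s) ((0 : Literature.Probability.LatticeModels.Site 3), ([] : List (ℤ × ℤ × ℤ))) p ≤ C * (s : ℝ) ^ ((5 : ℝ) / 6) * max 0 ((p : ℝ) - Literature.Probability.Percolation.criticalProb (G s) ((0 : Literature.Probability.LatticeModels.Site 3), ([] : List (ℤ × ℤ × ℤ))))) (fun s : ℕ => SimpleGraph.fromRel (fun x y : Literature.Probability.LatticeModels.Site 3 × List (ℤ × ℤ × ℤ) => (Literature.Probability.LatticeModels.zdGraph 3).Adj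 x.1 y.1 ∧ y.2 = (if y.1 = x.1 + (Pi.single 1 1 : Literature.Probability.LatticeModels.Site 3) ∧ (s : ℤ) ∣ x.1 1 - (s / 2 : ℕ) ∧ (x.1 0 - (s / 2 : ℕ)) % (s : ℤ) < (s / 2 : ℕ) ∧ x.1 2 % (s : ℤ) < (s / 2 : ℕ) then some ((x.1 0 - (s / 2 : ℕ)) / (s : ℤ), (x.1 1 - (s / 2 : ℕ)) / (s : ℤ), x.1 2 / (s : ℤ)) else if x.1 = y.1 + (Pi.single 1 1 : Literature.Probability.LatticeModels.Site 3) ∧ (s : ℤ) ∣ y.1 1 - (s / 2 : ℕ) ∧ (y.1 0 - (s / 2 : ℕ)) % (s : ℤ) < (s / 2 : ℕ) ∧ y.1 2 % (s : ℤ) < (s / 2 : ℕ) then some ((y.1 0 - (s / 2 : ℕ)) / (s : ℤ), (y.1 1 - (s / 2 : ℕ)) / (s : ℤ), y.1 2 / (s : ℤ)) else none).elim x.2 (fun P => if x.2.head? = some P then x.2.tail else P :: x.2)))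

/-- item stmt-CriticalPhenomena-6529 · crux · rank 3 · open · by planner
why it might fail: No polynomial bound on the subcritical correlation length of Z^3 is known at all (best: xi(p_c - eps) <= exp(C/eps^2), DuminilcopinKozmaTassion2020); a first proof would likely give a huge exponent, while the race needs nu' < 6/5 (truth nu ~ 0.88; a jump world may have nu = infinity).
sources: DuminilcopinKozmaTassion2020, DuminilCopinTassionCMP2016, Grimmett1999, AizenmanNewman1984, Hutchcroft2020
[crux] (card crux C2, ℤ³ part, least usable exponent) there are ν' < 6/5 and C such that for every p
< p_c(ℤ³) and every L ≥ C (p_c − p)^{−ν'} the finite-size criterion (2L+1)³ · P_p(0 ↔ ∂B(L)) ≤ 1/2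
holds (event `siteToBoundary 3 L`, the one of `perc_sharpness`); i.e. the subcritical correlation
length of bond percolation on ℤ³ obeys ξ(p_c − ε) log ξ ≲ ε^{−ν'} with ν' < 6/5 (numerics: ν ≈
0.876). Pure ℤ³, subcritical, shareable with other routes (cf. PercDebrisSweep's
SubcritChiBelowCube, PercTwoPointDecay r2). [difficulty: open-problem] -/
@[route_item "route-CriticalPhenomena-PercDislocationCovers"]
def Z3SubcritLengthExponent : Prop :=
  ∃ ν C : ℝ, ν < 6 / 5 ∧ ∀ p : unitInterval, (p : ℝ) < Literature.Probability.Percolation.criticalProb (Literature.Probability.LatticeModels.zdGraph 3) 0 → ∀ L : ℕ, C * (Literature.Probability.Percolation.criticalProb (Literature.Probability.LatticeModels.zdGraph 3) 0 - p) ^ (-ν) ≤ L → ((2 * L + 1) ^ 3 : ℝ) * (Literature.Probability.Percolation.bondPercolation (Literature.Probability.LatticeModels.zdGraph 3) p).real (Literature.Probability.Percolation.siteToBoundary 3 L) ≤ 1 / 2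

/-- item stmt-CriticalPhenomena-6530 · support · rank 9 · closed · proved by Summit.CriticalPhenomena.PercolationContinuityZ3.Theorems.CoverSubcritTransfer.coverSubcritTransfer_proof @ 1c19ccea0872 (prover) · by planner
sources: Grimmett1999, LyonsPeres2016, Literature.Probability.Percolation.bk_inequality_holds, Literature.Probability.Percolation.perc_sharpness_holds
[support] (card crux C2, cover part — made provable by FINITE cores) there is C₀ such that for all s
≥ 2, L ≥ 1 with C₀ L (log₂ L + 1) ≤ s and all p < p_c(ℤ³) satisfying the criterion (2L+1)³ P_p(0 ↔
∂B(L)) ≤ 1/2, the cover does not percolate: θ_{G_s}(õ, p) = 0. Proof plan (~1.5k lines): (i)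
Hammersley/Simon–Lieb iteration via bk_inequality_holds: P_p(0 ↔ ∂B(kL)) ≤ 2^{1−k}, so τ_p(y,z) ≤
2·2^{−|y−z|_∞/L}; (ii) geometry of the explicit cover: bonds outside the patches carry trivial
holonomy, so G_s minus the (finite!) lifted patch cores is a disjoint union of copies of F_s = ℤ³
minus patches ⊆ ℤ³, and each lifted core has ≤ 2·(s/2)²·2 vertices; (iii) core-to-core bridging
number m ≤ C s⁴ 2^{−s/(2L)} < 1 once s ≥ C₀ L log L (patches are ≥ s/2 apart); (iv) BK over chains
of distinct lifted cores ⇒ E[#cores in C(õ)] < ∞ ⇒ with a.s.-finite F-clusters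
(theta_eq_zero_of_lt_criticalProb_holds + subgraph monotonicity) C(õ) is a.s. finite. [difficulty:
L] -/
@[route_item "route-CriticalPhenomena-PercDislocationCovers"]
def CoverSubcritTransfer : Prop :=
  (fun G : ℕ → SimpleGraph (Literature.Probability.LatticeModels.Site 3 × List (ℤ × ℤ × ℤ)) => ∃ C₀ : ℕ, ∀ (s L : ℕ) (p : unitInterval), 2 ≤ s → 1 ≤ L → C₀ * L * (Nat.log 2 L + 1) ≤ s → (p : ℝ) < Literature.Probability.Percolation.criticalProb (Literature.Probability.LatticeModels.zdGraph 3) 0 → ((2 * L + 1) ^ 3 : ℝ) * (Literature.Probability.Percolation.bondPercolation (Literature.Probability.LatticeModels.zdGraph 3) p).real (Literature.Probability.Percolation.siteToBoundary 3 L) ≤ 1 / 2 → Literature.Probability.Percolation.theta (G s) ((0 : Literature.Probability.LatticeModels.Site 3), ([] : List (ℤ × ℤ × ℤ))) p = 0) (fun s : ℕ => SimpleGraph.fromRel (fun x y : Literature.Probability.LatticeModels.Site 3 × List (ℤ × ℤ × ℤ) => (Literature.Probability.LatticeModels.zdGraph 3).Adj x.1 y.1 ∧ y.2 = (if y.1 =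 x.1 + (Pi.single 1 1 : Literature.Probability.LatticeModels.Site 3) ∧ (s : ℤ) ∣ x.1 1 - (s / 2 : ℕ) ∧ (x.1 0 - (s / 2 : ℕ)) % (s : ℤ) < (s / 2 : ℕ) ∧ x.1 2 % (s : ℤ) < (s / 2 : ℕ) then some ((x.1 0 - (s / 2 : ℕ)) / (s : ℤ), (x.1 1 - (s / 2 : ℕ)) / (s : ℤ), x.1 2 / (s : ℤ)) else if x.1 = y.1 + (Pi.single 1 1 : Literature.Probability.LatticeModels.Site 3) ∧ (s : ℤ) ∣ y.1 1 - (s / 2 : ℕ) ∧ (y.1 0 - (s / 2 : ℕ)) % (s : ℤ) < (s / 2 : ℕ) ∧ y.1 2 % (s : ℤ) < (s / 2 : ℕ) then some ((y.1 0 - (s / 2 : ℕ)) / (s : ℤ), (y.1 1 - (s / 2 : ℕ)) / (s : ℤ), y.1 2 / (s : ℤ)) else none).elim x.2 (fun P => if x.2.head? = some P then x.2.tail else P :: x.2)))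

/-- item stmt-CriticalPhenomena-6531 · support · rank 9 · closed · proved by Summit.CriticalPhenomena.PercolationContinuityZ3.Theorems.PercDislocationCoversCoverMonotone.coverMonotone_proof @ 6aa50cc13111 (prover) · by planner
sources: LyonsPeres2016, BenjaminiSchramm1996, doi:10.1214/ecp.v1-978
[support] covering monotonicity (Campanino 1985; BenjaminiSchramm1996 Thm 1; LyonsPeres2016 Thm
6.47, pp. 316–317 of the held copy): if φ : V → W maps the G-neighbourhood of every vertex ONTO the
H-neighbourhood of its image (weak covering, vertex form), then θ_H(φ v, p) ≤ θ_G(v, p) for all v,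
p. Proof = LP's exploration coupling: explore C(φ v) in H edge by edge, lift each newly examined
edge to a fresh G-edge at the current lifted endpoint (exists by SurjOn; distinct H-edges lift to
distinct G-edges), copy its state; an infinite H-cluster lifts to an infinite open tree at v.
Countable V, W for measurability. [difficulty: provable-now] -/
@[route_item "route-CriticalPhenomena-PercDislocationCovers"]
def CoverMonotone : Prop :=
  ∀ {V W : Type} [Countable V] [Countable W] (G : SimpleGraph V) (H : SimpleGraph W) (φ : V → W), (∀ v : V, Set.SurjOn φ (G.neighborSet v) (H.neighborSet (φ v))) → ∀ (v : V) (p : unitInterval), Literature.Probability.Percolation.theta H (φ v) p ≤ Literature.Probability.Percolation.theta G v p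

/-- item stmt-CriticalPhenomena-6532 · support · rank 9 · closed · refuted by Summit.CriticalPhenomena.PercolationContinuityZ3.Theorems.PercLoopDislocationCoversCoverIsCovering_refuted @ 754796b272e2 (prover) · by planner
sources: LyonsPeres2016, BenjaminiSchramm1996
[support] sanity/canary for the explicit construction: for every s ≥ 2 and every vertex v of G_s,
Prod.fst restricted to the G_s-neighbours of v is a bijection onto the ℤ³-neighbours of v.1 (so
Prod.fst is a covering map and CoverMonotone applies with φ = Prod.fst, φ õ = 0). Finite case
analysis on the two `if` branches (the word update w ↦ toggle_P w is an involution; non-y-bonds and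
y-bonds off the patches keep the word). [difficulty: provable-now] -/
@[route_item "route-CriticalPhenomena-PercDislocationCovers"]
def CoverIsCovering : Prop :=
  (fun G : ℕ → SimpleGraph (Literature.Probability.LatticeModels.Site 3 × List (ℤ × ℤ × ℤ)) => ∀ s : ℕ, 2 ≤ s → ∀ v : Literature.Probability.LatticeModels.Site 3 × List (ℤ × ℤ × ℤ), Set.BijOn Prod.fst ((G s).neighborSet v) ((Literature.Probability.LatticeModels.zdGraph 3).neighborSet v.1)) (fun s : ℕ => SimpleGraph.fromRel (fun x y : Literature.Probability.LatticeModels.Site 3 × List (ℤ × ℤ × ℤ) => (Literature.Probability.LatticeModels.zdGraph 3).Adj x.1 y.1 ∧ y.2 = (if y.1 = x.1 + (Pi.single 1 1 : Literature.Probability.LatticeModels.Site 3) ∧ (s : ℤ) ∣ x.1 1 - (s / 2 : ℕ) ∧ (x.1 0 - (s / 2 : ℕ)) % (s : ℤ) < (s / 2 : ℕ) ∧ x.1 2 % (s : ℤ) < (s / 2 : ℕ) then some ((x.1 0 - (s / 2 : ℕ)) / (s : ℤ), (x.1 1 - (s / 2 : ℕ)) / (s : ℤ), x.1 2 / (s :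 ℤ)) else if x.1 = y.1 + (Pi.single 1 1 : Literature.Probability.LatticeModels.Site 3) ∧ (s : ℤ) ∣ y.1 1 - (s / 2 : ℕ) ∧ (y.1 0 - (s / 2 : ℕ)) % (s : ℤ) < (s / 2 : ℕ) ∧ y.1 2 % (s : ℤ) < (s / 2 : ℕ) then some ((y.1 0 - (s / 2 : ℕ)) / (s : ℤ), (y.1 1 - (s / 2 : ℕ)) / (s : ℤ), y.1 2 / (s : ℤ)) else none).elim x.2 (fun P => if x.2.head? = some P then x.2.tail else P :: x.2)))

/-- item stmt-CriticalPhenomena-6533 · assembly · rank 1 · closed · proved by Summit.CriticalPhenomena.PercolationContinuityZ3.Theorems.PercDislocationCoversAssembly.assembly_proof @ 92bb82197b47 (prover) · by planner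
sources: LyonsPeres2016, Grimmett1999
[assembly] CoverMonotone → CoverIsCovering → CoverSubcritTransfer → Z3SubcritLengthExponent →
CoverSlopeBound → PercolationContinuityZ3 (the root-level conjunct abbrev of
Summits/CriticalPhenomena/PercolationContinuityZ3/Statement.lean). -/
@[route_item "route-CriticalPhenomena-PercDislocationCovers"]
def Assembly : Prop :=
  CoverMonotone → CoverIsCovering → CoverSubcritTransfer → Z3SubcritLengthExponent → CoverSlopeBound → PercolationContinuityZ3

end Summit.CriticalPhenomena.PercolationContinuityZ3.Theses.PercDislocationCovers
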